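import Literature.NumberTheory.Automorphic.BockleHuiIrreducibleGL3ReductionProofs
import Literature.NumberTheory.Automorphic.ReciprocityGLnRankOneProofs
import Literature.NumberTheory.GaloisRepresentations.WeakAbelianDirectSummandCyclotomicProofs
import HarnessLib

/-!
# `ReducibleForcesEssSelfDual` (route `IrreducibilityBySelfDuality`, item stmt-Langlands-13619) —
# the Galois-side dictionary, place by place

Helper file (`--supports stmt-Langlands-13619`) for the support item `ReducibleForcesEssSelfDual` of
the route `Summits/Langlands/Langlands/Theses/IrreducibilityBySelfDuality.lean`: Böckle–Hui 2025,
§3.2.1 made field-independent and re-run with compatibility only at ALMOST ALL places.  The tree's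
pipeline (`BockleHuiIrreducibleGL3Proofs`, `…ReductionProofs`) takes the unramified compatibility
of lang.S27 at EVERY place `v ∤ ℓ`; the item only grants it on a cofinite set of places, so the
pointwise content of those lemmas is re-proved here from the local hypotheses at ONE place `v`
(`r` unramified at `v` with Frobenius polynomial `arithFrobPolyOfSatake ι q_v n α`):

* `charpoly_dvd_of_stableLine` — the character `τ` on an `r`-stable line divides `r`:
  `charpoly (τ g) ∣ charpoly (r g)` for EVERY `g` (an eigenvalue is a root of the characteristic
  polynomial); this is the weak-divisibility input of Böckle–Hui's Thm. 1.1 in the GL(1) form of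
  the route's input `WeakAbelianSummandHecke`.
* `stableLine_isUnramifiedAt_and_det_eq_of_frob` — at a good place, `τ` is unramified and
  `det τ(Frob) = ι⁻¹((q_v^{(n-1)/2} a)⁻¹)` for some `a ∈ α`.
* `exists_polynomial_map_eq_arithFrobPolyOfSatake_three` — for `n = 3`, if the Hecke eigenvalues
  `q e₁(α), q e₂(α), e₃(α)` lie in a subfield `E ⊆ ℂ` then `arithFrobPolyOfSatake ι q 3 α` is
  the image of a polynomial over `E` under `ι⁻¹|_E` (BH §3.1, `E`-rationality from Clozel's
  Hecke field); `eventually_rational_of_heckeEigenvalue_mem` is its cofinite form.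
* `eventually_weaklyDivides_of_stableLine` — the cofinite weak-divisibility hypothesis.
* `exists_heckeCharacter_mem_satake_of_glOne` — the dictionary back: if the GL(1) datum `χ`
  attached to `τ` by Thm. 1.1 has Satake parameter `{c_v}` with `τ(Frob_v) = ι⁻¹(c_v⁻¹)` a.e.,
  then `c_v = q_v a_v` with `a_v ∈ α_v`, and the Hecke character `μ = χ ‖·‖` of `χ` twisted by
  the norm has `μ(ϖ_v) ∈ α_v` at almost every `v` (BH §3.2.1: "(Alt) and (lg)").

References: G. Böckle, C.-Y. Hui, Math. Ann. 393 (2025), §3.1–§3.2.1 (arXiv:2404.08954, p. 13).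
-/

noncomputable section

set_option linter.dupNamespace false -- project-wide option (lakefile weak.linter.dupNamespace); `Summit.Langlands.Langlands` is the mandated namespace

open scoped NumberField Matrix Polynomial Classical
open NumberField IsDedekindDomain Field Polynomial Filter
open Literature.NumberTheory.Automorphic Literature.NumberTheory.GaloisRepresentations

namespace Summit.Langlands.Langlands.Theorems.ReducibleForcesEssSelfDual

/-! ### Rank-one characteristic polynomials and the divisibility of a stable line -/

section RankOne

variable {G A : Type*} [Group G] [TopologicalSpace G] [CommRing A] [TopologicalSpace A]

/-- For a framed representation of rank one, `charpoly (τ g) = X - det (τ g)`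
(Mathlib `Matrix.det_fin_one`, `Matrix.charmatrix_apply_eq`). [folklore] -/
theorem charpoly_eq_X_sub_C_det_of_rank_one (τ : FramedRep G A 1) (g : G) :
    FramedRep.charpoly τ g = X - C ((Matrix.GeneralLinearGroup.det (τ g) : Aˣ) : A) := by
  rw [FramedRep.charpoly, Matrix.charpoly, Matrix.det_fin_one, Matrix.charmatrix_apply_eq,
    Matrix.GeneralLinearGroup.val_det_apply, Matrix.det_fin_one]

end RankOne

section Divisibility

variable {G A : Type*} [Group G] [TopologicalSpace G] [Field A] [TopologicalSpace A] {n : ℕ}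

/-- **A character on a stable line divides the representation.**  If `x ≠ 0` spans an `r`-stable
line with character `τ` (`r(g) x = det(τ g) • x`), then `charpoly (τ g) = X - det(τ g)` divides
`charpoly (r g)` for every `g`: `det(τ g)` is an eigenvalue of `r g`, hence a root of its
characteristic polynomial (Mathlib `Matrix.eval_charpoly`, `Matrix.exists_mulVec_eq_zero_iff`,
`Polynomial.dvd_iff_isRoot`).  Böckle–Hui §1.1: abelian direct summands are weak abelian direct
summands. [folklore] -/
theorem charpoly_dvd_of_stableLine (r : FramedRep G A n) {τ : FramedRep G A 1} {x : Fin n → A}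
    (hx0 : x ≠ 0)
    (hx : ∀ g : G, r.toRepresentation g x = ((Matrix.GeneralLinearGroup.det (τ g) : Aˣ) : A) • x)
    (g : G) : FramedRep.charpoly τ g ∣ FramedRep.charpoly r g := by
  classical
  rw [charpoly_eq_X_sub_C_det_of_rank_one, Polynomial.dvd_iff_isRoot, IsRoot.def, FramedRep.charpoly,
    Matrix.eval_charpoly, ← Matrix.exists_mulVec_eq_zero_iff]
  refine ⟨x, hx0, ?_⟩
  have hmul : ((r g : GL (Fin n) A) : Matrix (Fin n) (Fin n) A) *ᵥ x =
      ((Matrix.GeneralLinearGroup.det (τ g) : Aˣ) : A) • x := by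
    simpa using hx g
  rw [Matrix.sub_mulVec, hmul]
  ext j
  simp [Matrix.scalar_apply]

end Divisibility

/-! ### One good place: unramifiedness of the character and its Frobenius value -/

section OnePlace

variable {K : Type} [Field K] [NumberField K] {ℓ : ℕ} [Fact ℓ.Prime] {n : ℕ}

/-- **The character on a stable line at a good place.**  If `r(g) x = det(τ g) • x` (`x ≠ 0`),
`r` is unramified at `v` and `det(X - r(Frob_v)) = arithFrobPolyOfSatake ι q_v n α` for the
arithmetic Frobenii at `v`, then `τ` is unramified at `v` (inertia fixes `x`) and for every
arithmetic Frobenius `σ` at a prime above `v`, `det τ(σ) = ι⁻¹((q_v^{(n-1)/2} a)⁻¹)` for some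
`a ∈ α` (an eigenvalue on the line is a root of the characteristic polynomial,
`roots_arithFrobPolyOfSatake`).  Pointwise form of the tree's
`stableLine_isUnramifiedAt_and_det_eq`. [cite: BockleHui2025, §3.2.1] -/
theorem stableLine_isUnramifiedAt_and_det_eq_of_frob (ι : PadicAlgCl ℓ ≃+* ℂ)
    (r : FramedGaloisRep K (PadicAlgCl ℓ) n)
    {τ : FramedGaloisRep K (PadicAlgCl ℓ) 1} {x : Fin n → PadicAlgCl ℓ} (hx0 : x ≠ 0)
    (hx : ∀ g : absoluteGaloisGroup K,
      r.toGaloisRep g x = ((Matrix.GeneralLinearGroup.det (τ g) : (PadicAlgCl ℓ)ˣ) : PadicAlgCl ℓ) • x)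
    {v : HeightOneSpectrum (𝓞 K)} {α : Multiset ℂ} (hunr : r.IsUnramifiedAt v)
    (hP : r.HasFrobCharpolyAt v (arithFrobPolyOfSatake ι v.residueCard n α)) :
    τ.IsUnramifiedAt v ∧
      ∀ 𝔓 ∈ v.primesAbove, ∀ σ : absoluteGaloisGroup K, IsArithFrobAt (𝓞 K) σ 𝔓 →
        ∃ a ∈ α, ((Matrix.GeneralLinearGroup.det (τ σ) : (PadicAlgCl ℓ)ˣ) : PadicAlgCl ℓ) =
          ι.symm ((((Real.sqrt (v.residueCard : ℝ) : ℝ) : ℂ) ^ (n - 1) * a)⁻¹) := by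
  classical
  -- matrix form of the eigenvector equation
  have hmul : ∀ g : absoluteGaloisGroup K,
      ((r g : GL (Fin n) (PadicAlgCl ℓ)) : Matrix (Fin n) (Fin n) (PadicAlgCl ℓ)) *ᵥ x =
        ((Matrix.GeneralLinearGroup.det (τ g) : (PadicAlgCl ℓ)ˣ) : PadicAlgCl ℓ) • x := fun g => by
    simpa using hx g
  obtain ⟨i, hi⟩ : ∃ i, x i ≠ 0 := Function.ne_iff.mp hx0
  refine ⟨?_, ?_⟩
  · -- unramified: inertia acts trivially on `x ≠ 0`, so the scalar is `1`
    intro 𝔓 h𝔓 σ hσ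
    have h1 : r σ = 1 := hunr 𝔓 h𝔓 σ hσ
    have h2 := hmul σ
    rw [h1] at h2
    simp only [Units.val_one, Matrix.one_mulVec] at h2
    have h3 : ((Matrix.GeneralLinearGroup.det (τ σ) : (PadicAlgCl ℓ)ˣ) : PadicAlgCl ℓ) * x i = x i := by
      simpa using (congrFun h2 i).symm
    have hd : ((Matrix.GeneralLinearGroup.det (τ σ) : (PadicAlgCl ℓ)ˣ) : PadicAlgCl ℓ) = 1 :=
      (mul_eq_right₀ hi).1 h3
    refine Units.ext (Matrix.ext fun j k => ?_)
    have hdet : ((τ σ : GL (Fin 1) (PadicAlgCl ℓ)) : Matrix (Fin 1) (Fin 1) (PadicAlgCl ℓ)).det = 1 := by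
      rw [← Matrix.GeneralLinearGroup.val_det_apply, hd]
    rw [Matrix.det_fin_one] at hdet
    rw [Subsingleton.elim j 0, Subsingleton.elim k 0, hdet]
    simp
  · -- Frobenius value: an eigenvalue is a root of the characteristic polynomial
    intro 𝔓 h𝔓 σ hσ
    set d : PadicAlgCl ℓ := ((Matrix.GeneralLinearGroup.det (τ σ) : (PadicAlgCl ℓ)ˣ) : PadicAlgCl ℓ)
    have hchar : FramedRep.charpoly r σ = arithFrobPolyOfSatake ι v.residueCard n α := hP 𝔓 h𝔓 σ hσ
    have hroot : (FramedRep.charpoly r σ).IsRoot d := by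
      rw [IsRoot.def, FramedRep.charpoly, Matrix.eval_charpoly, ← Matrix.exists_mulVec_eq_zero_iff]
      refine ⟨x, hx0, ?_⟩
      rw [Matrix.sub_mulVec, hmul σ]
      ext j
      simp [Matrix.scalar_apply, d]
    have hne : arithFrobPolyOfSatake ι v.residueCard n α ≠ 0 := by
      refine (Polynomial.monic_multiset_prod_of_monic _ _ fun a _ => ?_).ne_zero
      exact Polynomial.monic_X_sub_C _
    have hmem : d ∈ (arithFrobPolyOfSatake ι v.residueCard n α).roots := by
      rw [Polynomial.mem_roots hne, ← hchar]
      exact hroot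
    rw [roots_arithFrobPolyOfSatake, Multiset.mem_map] at hmem
    obtain ⟨a, ha, hda⟩ := hmem
    exact ⟨a, ha, hda.symm⟩

/-- **The value `c_v` of the GL(1) datum of the stable line is `q_v` times a Satake eigenvalue.**
At a good place `v` of a rank-three `r` (unramified, Frobenius polynomial
`arithFrobPolyOfSatake ι q_v 3 α`), if the character `τ` of an `r`-stable line has Frobenius
polynomial `arithFrobPolyOfSatake ι q_v 1 {c} = X - ι⁻¹(c⁻¹)` at `v` (the output of Böckle–Hui's
Thm. 1.1 in GL(1) form), then `c = q_v a` for some `a ∈ α`: a Frobenius at `v` exists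
(`exists_isArithFrobAt_of_mem_primesAbove_holds`), and both `ι⁻¹(c⁻¹)` and `ι⁻¹((q_v a)⁻¹)` are
`det τ(Frob_v)`. [cite: BockleHui2025, §3.2.1] -/
theorem exists_eq_residueCard_mul_of_frob (ι : PadicAlgCl ℓ ≃+* ℂ)
    (r : FramedGaloisRep K (PadicAlgCl ℓ) 3)
    {τ : FramedGaloisRep K (PadicAlgCl ℓ) 1} {x : Fin 3 → PadicAlgCl ℓ} (hx0 : x ≠ 0)
    (hx : ∀ g : absoluteGaloisGroup K,
      r.toGaloisRep g x = ((Matrix.GeneralLinearGroup.det (τ g) : (PadicAlgCl ℓ)ˣ) : PadicAlgCl ℓ) • x)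
    {v : HeightOneSpectrum (𝓞 K)} {α : Multiset ℂ} (hunr : r.IsUnramifiedAt v)
    (hP : r.HasFrobCharpolyAt v (arithFrobPolyOfSatake ι v.residueCard 3 α)) {c : ℂ}
    (hτ : τ.HasFrobCharpolyAt v (arithFrobPolyOfSatake ι v.residueCard 1 {c})) :
    ∃ a ∈ α, c = (v.residueCard : ℂ) * a := by
  obtain ⟨𝔓, h𝔓⟩ := HeightOneSpectrum.primesAbove_nonempty v
  obtain ⟨σ, hσ⟩ := HeightOneSpectrum.exists_isArithFrobAt_of_mem_primesAbove_holds h𝔓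
  obtain ⟨a, ha, hdet⟩ :=
    (stableLine_isUnramifiedAt_and_det_eq_of_frob ι r hx0 hx hunr hP).2 𝔓 h𝔓 σ hσ
  refine ⟨a, ha, ?_⟩
  have hch := hτ 𝔓 h𝔓 σ hσ
  rw [arithFrobPolyOfSatake_one, Multiset.map_singleton, Multiset.prod_singleton,
    charpoly_eq_X_sub_C_det_of_rank_one, sub_right_inj, Polynomial.C_inj, hdet] at hch
  have h2 := ι.symm.injective hch
  rw [inv_inj] at h2
  have hsq2 : ((Real.sqrt (v.residueCard : ℝ) : ℝ) : ℂ) ^ (3 - 1) = (v.residueCard : ℂ) := by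
    rw [show (3 - 1 : ℕ) = 2 from rfl, ← Complex.ofReal_pow, Real.sq_sqrt (Nat.cast_nonneg _),
      Complex.ofReal_natCast]
  rw [hsq2] at h2
  exact h2.symm

end OnePlace

/-! ### `E`-rationality at a good place (BH §3.1 for `n = 3`) -/

section Rational

variable {ℓ : ℕ} [Fact ℓ.Prime]

/-- **`arithFrobPolyOfSatake ι q 3 α` is defined over the Hecke field.**  If `α = {a, b, c}` has
non-zero entries and the unramified Hecke eigenvalues `t_i = (√q)^{i(3-i)} e_i(α)` (`i ≤ 3`) lie
in the subfield `E ⊆ ℂ`, then `∏_{a ∈ α} (X - ι⁻¹((q a)⁻¹)) = X³ - ι⁻¹(e₂/(q e₃)) X² +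
ι⁻¹(e₁/(q² e₃)) X - ι⁻¹(1/(q³ e₃))` is the image under `ι⁻¹|_E` of a polynomial over `E`.
Pointwise form of the tree's `isRationalOver_of_heckeEigenvalue_mem_three` (Böckle–Hui §3.1:
"the Satake parameters of `π_v ⊗ |det|_v^{(1-n)/2}` are defined over `E` … `ρ_{π,ι}` … is
`E`-rational"). [cite: BockleHui2025, §3.1] -/
theorem exists_polynomial_map_eq_arithFrobPolyOfSatake_three (ι : PadicAlgCl ℓ ≃+* ℂ)
    (E : Subfield ℂ) {q : ℕ} (hq : 0 < q) {α : Multiset ℂ} (hcard : Multiset.card α = 3)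
    (hne : ∀ a ∈ α, a ≠ 0)
    (hE : ∀ i ≤ 3, ((((Real.sqrt (q : ℝ)) : ℝ) : ℂ) ^ (i * (3 - i))) * α.esymm i ∈ E) :
    ∃ P : Polynomial E,
      P.map ((ι.symm : ℂ ≃+* PadicAlgCl ℓ).toRingHom.comp E.subtype) = arithFrobPolyOfSatake ι q 3 α := by
  have ht1 := hE 1 (by norm_num)
  have ht2 := hE 2 (by norm_num)
  have ht3 := hE 3 le_rfl
  obtain ⟨a, b, c, rfl⟩ := Multiset.card_eq_three.1 hcard
  have ha : a ≠ 0 := hne a (by simp)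
  have hb : b ≠ 0 := hne b (by simp)
  have hc : c ≠ 0 := hne c (by simp)
  rw [esymm_one_triple] at ht1
  rw [esymm_two_triple] at ht2
  rw [esymm_three_triple] at ht3
  norm_num at ht1 ht2 ht3
  -- `√q`
  set sq : ℂ := ((Real.sqrt (q : ℝ) : ℝ) : ℂ) with hsq
  have hsq2 : sq ^ 2 = (q : ℂ) := by
    rw [hsq, ← Complex.ofReal_pow, Real.sq_sqrt (Nat.cast_nonneg _), Complex.ofReal_natCast]
  have hsq0 : sq ≠ 0 := by
    rw [hsq, Complex.ofReal_ne_zero]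
    exact Real.sqrt_ne_zero'.2 (by exact_mod_cast hq)
  have hqE : sq ^ 2 ∈ E := by rw [hsq2]; exact natCast_mem E q
  -- `e₁, e₂ ∈ E` (and `e₃ ∈ E` is `ht3`)
  have he1 : a + b + c ∈ E := by
    have h := mul_mem (inv_mem hqE) ht1
    rwa [inv_mul_cancel_left₀ (pow_ne_zero 2 hsq0)] at h
  have he2 : a * b + a * c + b * c ∈ E := by
    have h := mul_mem (inv_mem hqE) ht2
    rwa [inv_mul_cancel_left₀ (pow_ne_zero 2 hsq0)] at h
  -- the inverse roots `u = (q a)⁻¹`, `w = (q b)⁻¹`, `z = (q c)⁻¹` and their symmetric functions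
  set u : ℂ := (sq ^ 2 * a)⁻¹ with hu
  set w : ℂ := (sq ^ 2 * b)⁻¹ with hw
  set z : ℂ := (sq ^ 2 * c)⁻¹ with hz
  have hS1 : u + w + z ∈ E := by
    have e : u + w + z = (a * b + a * c + b * c) * (sq ^ 2 * (a * b * c))⁻¹ := by
      rw [hu, hw, hz]
      field_simp
      ring
    rw [e]
    exact mul_mem he2 (inv_mem (mul_mem hqE ht3))
  have hS2 : u * w + u * z + w * z ∈ E := by
    have e : u * w + u * z + w * z = (a + b + c) * (sq ^ 2 * sq ^ 2 * (a * b * c))⁻¹ := by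
      rw [hu, hw, hz]
      field_simp
      ring
    rw [e]
    exact mul_mem he1 (inv_mem (mul_mem (mul_mem hqE hqE) ht3))
  have hS3 : u * w * z ∈ E := by
    have e : u * w * z = (sq ^ 2 * sq ^ 2 * sq ^ 2 * (a * b * c))⁻¹ := by
      rw [hu, hw, hz]
      field_simp
    rw [e]
    exact inv_mem (mul_mem (mul_mem (mul_mem hqE hqE) hqE) ht3)
  refine ⟨X ^ 3 - C (⟨u + w + z, hS1⟩ : E) * X ^ 2 + C (⟨u * w + u * z + w * z, hS2⟩ : E) * X -
    C (⟨u * w * z, hS3⟩ : E), ?_⟩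
  simp only [arithFrobPolyOfSatake, Multiset.insert_eq_cons, Multiset.map_cons,
    Multiset.map_singleton, Multiset.prod_cons, Multiset.prod_singleton, Polynomial.map_add,
    Polynomial.map_sub, Polynomial.map_mul, Polynomial.map_pow, map_X, map_C,
    RingHom.coe_comp, Function.comp_apply, RingEquiv.toRingHom_eq_coe, RingEquiv.coe_toRingHom,
    Subfield.coe_subtype, map_add, map_mul]
  have h31 : (3 - 1 : ℕ) = 2 := rfl
  rw [h31, ← hsq, ← hu, ← hw, ← hz]
  ring

end Rational

/-! ### Cofinite forms, for an `r` compatible with `π` at almost all places -/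

section Cofinite

variable {K : Type} [Field K] [NumberField K] {hcpt : isCompact_glFiniteIntegralLevel 3 K}
  {ℓ : ℕ} [Fact ℓ.Prime]

/-- **Cofinite `E`-rationality** (the `E`-rationality hypothesis of the route's input
`WeakAbelianSummandHecke`, from its input `HeckeEigenvalueField`): if `r` is compatible with `π`
at almost all places in the C-normalisation and the Hecke eigenvalues of `π` lie in `E ⊆ ℂ` at
almost all places, then at almost all `v`, `r` is unramified with a Frobenius polynomial defined
over `E` (via `ι⁻¹|_E`). [cite: BockleHui2025, §3.1] -/
theorem eventually_rational_of_heckeEigenvalue_mem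
    (π : AutomorphicRepData (AutomorphyDatum.gl 3 K hcpt)) (ι : PadicAlgCl ℓ ≃+* ℂ)
    (r : FramedGaloisRep K (PadicAlgCl ℓ) 3)
    (hr : ∀ᶠ v : HeightOneSpectrum (𝓞 K) in cofinite, ∀ α : Multiset ℂ, π.HasSatakeParamAt v α →
      r.IsUnramifiedAt v ∧ r.HasFrobCharpolyAt v (arithFrobPolyOfSatake ι v.residueCard 3 α))
    (E : Subfield ℂ)
    (hE : ∀ᶠ v : HeightOneSpectrum (𝓞 K) in cofinite, ∀ α : Multiset ℂ, π.HasSatakeParamAt v α →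
      ∀ i ≤ 3, ((((Real.sqrt (v.residueCard : ℝ)) : ℝ) : ℂ) ^ (i * (3 - i))) * α.esymm i ∈ E) :
    ∀ᶠ v : HeightOneSpectrum (𝓞 K) in cofinite, r.IsUnramifiedAt v ∧
      ∃ P : Polynomial E,
        r.HasFrobCharpolyAt v (P.map ((ι.symm : ℂ ≃+* PadicAlgCl ℓ).toRingHom.comp E.subtype)) := by
  have hcof : ∀ᶠ v : HeightOneSpectrum (𝓞 K) in cofinite, π.IsUnramifiedAt v :=
    π.hasSatakeParamAt_cofinite_holds
  filter_upwards [hcof, hr, hE] with v hv hrv hEv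
  obtain ⟨α, hα⟩ := hv
  obtain ⟨hunr, hP⟩ := hrv α hα
  refine ⟨hunr, ?_⟩
  obtain ⟨P, hPmap⟩ := exists_polynomial_map_eq_arithFrobPolyOfSatake_three ι E
    (lt_trans zero_lt_one v.one_lt_residueCard) hα.card_eq (hasSatakeParamAt_ne_zero_holds hα)
    (hEv α hα)
  exact ⟨P, fun 𝔓 h𝔓 σ hσ => (hP 𝔓 h𝔓 σ hσ).trans hPmap.symm⟩

/-- **Cofinite weak divisibility of the character of a stable line** (the divisibility hypothesis
of the route's input `WeakAbelianSummandHecke`): at almost all `v`, `r` and `τ` are unramified and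
`charpoly τ(σ) ∣ charpoly r(σ)` for the arithmetic Frobenii `σ` at `v` (indeed for every `σ`,
`charpoly_dvd_of_stableLine`). Böckle–Hui §1.1 / Def. 2.3. [cite: BockleHui2025, §1.1] -/
theorem eventually_weaklyDivides_of_stableLine
    (π : AutomorphicRepData (AutomorphyDatum.gl 3 K hcpt)) (ι : PadicAlgCl ℓ ≃+* ℂ)
    (r : FramedGaloisRep K (PadicAlgCl ℓ) 3)
    (hr : ∀ᶠ v : HeightOneSpectrum (𝓞 K) in cofinite, ∀ α : Multiset ℂ, π.HasSatakeParamAt v α →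
      r.IsUnramifiedAt v ∧ r.HasFrobCharpolyAt v (arithFrobPolyOfSatake ι v.residueCard 3 α))
    {τ : FramedGaloisRep K (PadicAlgCl ℓ) 1} {x : Fin 3 → PadicAlgCl ℓ} (hx0 : x ≠ 0)
    (hx : ∀ g : absoluteGaloisGroup K,
      r.toGaloisRep g x = ((Matrix.GeneralLinearGroup.det (τ g) : (PadicAlgCl ℓ)ˣ) : PadicAlgCl ℓ) • x) :
    ∀ᶠ v : HeightOneSpectrum (𝓞 K) in cofinite, r.IsUnramifiedAt v ∧ τ.IsUnramifiedAt v ∧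
      ∀ 𝔓 ∈ v.primesAbove, ∀ σ : absoluteGaloisGroup K, IsArithFrobAt (𝓞 K) σ 𝔓 →
        τ.charpoly σ ∣ r.charpoly σ := by
  have hcof : ∀ᶠ v : HeightOneSpectrum (𝓞 K) in cofinite, π.IsUnramifiedAt v :=
    π.hasSatakeParamAt_cofinite_holds
  have hx' : ∀ g : absoluteGaloisGroup K,
      r.toRepresentation g x = ((Matrix.GeneralLinearGroup.det (τ g) : (PadicAlgCl ℓ)ˣ) : PadicAlgCl ℓ) • x :=
    fun g => by simpa using hx g
  filter_upwards [hcof, hr] with v hv hrv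
  obtain ⟨α, hα⟩ := hv
  obtain ⟨hunr, hP⟩ := hrv α hα
  exact ⟨hunr, (stableLine_isUnramifiedAt_and_det_eq_of_frob ι r hx0 hx hunr hP).1,
    fun 𝔓 _ σ _ => charpoly_dvd_of_stableLine r hx0 hx' σ⟩

/-- **From the GL(1) datum of the stable line to a Hecke character among the Satake eigenvalues**
(BH §3.2.1, "(Alt) and the local-global compatibility (lg)", cofinite and field-independent).  Let
`r` be compatible with `π` at almost all places (C-normalisation), `τ` the character of an
`r`-stable line, and `χ` a cuspidal GL(1) datum with, at almost all `v`, Satake parameter `{c_v}`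
and `τ(Frob_v)` of characteristic polynomial `arithFrobPolyOfSatake ι q_v 1 {c_v}` (the output of
Böckle–Hui's Thm. 1.1 in GL(1) form).  Then the Hecke character `μ = χ_π ‖·‖` — `χ_π` the Hecke
character of the datum `χ` (`exists_heckeCharacter_glOne`; `c_v = χ_π(ϖ_v)` by
`exists_eq_singleton_of_hasSatakeParamAt_glOne`), `‖ϖ_v‖ = q_v⁻¹`
(`valueAtUniformizer_normCharacter`) — satisfies `μ(ϖ_v) ∈ α_v` at almost every `v`, because
`c_v = q_v a_v` with `a_v ∈ α_v` (`exists_eq_residueCard_mul_of_frob`). [cite: BockleHui2025, §3.2.1] -/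
theorem exists_heckeCharacter_mem_satake_of_glOne {h1 : isCompact_glFiniteIntegralLevel 1 K}
    (π : AutomorphicRepData (AutomorphyDatum.gl 3 K hcpt)) (ι : PadicAlgCl ℓ ≃+* ℂ)
    (r : FramedGaloisRep K (PadicAlgCl ℓ) 3)
    (hr : ∀ᶠ v : HeightOneSpectrum (𝓞 K) in cofinite, ∀ α : Multiset ℂ, π.HasSatakeParamAt v α →
      r.IsUnramifiedAt v ∧ r.HasFrobCharpolyAt v (arithFrobPolyOfSatake ι v.residueCard 3 α))
    {τ : FramedGaloisRep K (PadicAlgCl ℓ) 1} {x : Fin 3 → PadicAlgCl ℓ} (hx0 : x ≠ 0)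
    (hx : ∀ g : absoluteGaloisGroup K,
      r.toGaloisRep g x = ((Matrix.GeneralLinearGroup.det (τ g) : (PadicAlgCl ℓ)ˣ) : PadicAlgCl ℓ) • x)
    (χ : CuspidalAutomorphicRepData 1 K h1)
    (hχ : ∀ᶠ v : HeightOneSpectrum (𝓞 K) in cofinite, ∃ c : ℂ, χ.1.HasSatakeParamAt v {c} ∧
      τ.IsUnramifiedAt v ∧ τ.HasFrobCharpolyAt v (arithFrobPolyOfSatake ι v.residueCard 1 {c})) :
    ∃ μ : HeckeCharacter K, ∀ᶠ v : HeightOneSpectrum (𝓞 K) in cofinite, ∀ α : Multiset ℂ,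
      π.HasSatakeParamAt v α → μ.valueAtUniformizer v ∈ α := by
  obtain ⟨θ, hθ⟩ := χ.1.exists_heckeCharacter_glOne
  refine ⟨θ * HeckeCharacter.normCharacter K, ?_⟩
  filter_upwards [hr, hχ] with v hrv hχv α hα
  obtain ⟨c, hc, -, hτc⟩ := hχv
  obtain ⟨hunr, hP⟩ := hrv α hα
  obtain ⟨a, ha, hca⟩ := exists_eq_residueCard_mul_of_frob ι r hx0 hx hunr hP hτc
  -- `c = θ(ϖ_v)`
  obtain ⟨ϖ, hϖ, hcϖ⟩ := χ.1.exists_eq_singleton_of_hasSatakeParamAt_glOne hθ hc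
  have hur : θ.IsUnramifiedAt v := χ.1.isUnramifiedAt_heckeCharacter_glOne hθ hc
  have hθc : θ.valueAtUniformizer v = c := by
    rw [← HeckeCharacter.localComponent_eq_valueAtUniformizer hur hϖ,
      HeckeCharacter.localComponent_apply]
    exact (Multiset.singleton_inj.1 hcϖ).symm
  have hq0 : (v.residueCard : ℂ) ≠ 0 := by
    exact_mod_cast (lt_trans zero_lt_one v.one_lt_residueCard).ne'
  have hval : (θ * HeckeCharacter.normCharacter K).valueAtUniformizer v = a := by
    have hmul : (θ * HeckeCharacter.normCharacter K).valueAtUniformizer v =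
        θ.valueAtUniformizer v * (HeckeCharacter.normCharacter K).valueAtUniformizer v := by
      simp only [HeckeCharacter.valueAtUniformizer, HeckeCharacter.localComponent_apply,
        HeckeCharacter.mul_apply, Units.val_mul]
    rw [hmul, HeckeCharacter.valueAtUniformizer_normCharacter, hθc, hca, mul_comm, ← mul_assoc,
      inv_mul_cancel₀ hq0, one_mul]
  rw [hval]
  exact ha

end Cofinite

end Summit.Langlands.Langlands.Theorems.ReducibleForcesEssSelfDual

end
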